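/-
Summits.FinalStateConjecture.HardCores — GENERATED by harness/kit/hardcore_registry.py (2026-08-18T11:48:14Z) from harness/kit/hardcore_seeds.json (FILTER-SYNTHESIS 2026-08-18 F1).
Tags existing OPEN statement items as famous open sub-summit problems (`@[hard_core]`); the kernel tribunal (t1h) flags routes whose crux meets one
(frontier shelf, never a fail; the owner route is exempt). 7 item(s) tagged; 0 unresolved: []
NEVER import this from a Theorems/Theses/Cruxes file.
-/
import Summits.FinalStateConjecture.FinalStateConjecture.Theses.TangentProfileCensorship
import Summits.FinalStateConjecture.FinalStateConjecture.Theses.LambdaRegulator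
import Summits.FinalStateConjecture.FinalStateConjecture.Theses.KerrBurial
import Summits.FinalStateConjecture.FinalStateConjecture.Theses.CriticalAncestry
import Summits.FinalStateConjecture.FinalStateConjecture.Theses.PhaseMixingCapture
import Summits.FinalStateConjecture.FinalStateConjecture.Theses.EternalPapapetrou
import HarnessLib.Audit.TribunalTags

-- stmt-FinalStateConjecture-9937 · MGHDExistence · MGHD existence (Choquet-Bruhat–Geroch) as a stated fact
attribute [hard_core "FinalStateConjecture" "MGHD existence (Choquet-Bruhat–Geroch) as a stated fact"] Summit.FinalStateConjecture.FinalStateConjecture.Theses.TangentProfileCensorship.MGHDExistence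
-- stmt-FinalStateConjecture-9990 · MGHDExistence · MGHD existence (Choquet-Bruhat–Geroch) as a stated fact
attribute [hard_core "FinalStateConjecture" "MGHD existence (Choquet-Bruhat–Geroch) as a stated fact"] Summit.FinalStateConjecture.FinalStateConjecture.Theses.LambdaRegulator.MGHDExistence
-- stmt-FinalStateConjecture-10009 · MGHDExistence · MGHD existence (Choquet-Bruhat–Geroch) as a stated fact
attribute [hard_core "FinalStateConjecture" "MGHD existence (Choquet-Bruhat–Geroch) as a stated fact"] Summit.FinalStateConjecture.FinalStateConjecture.Theses.KerrBurial.MGHDExistence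
-- stmt-FinalStateConjecture-10072 · MGHDExists · MGHD existence (Choquet-Bruhat–Geroch) as a stated fact
attribute [hard_core "FinalStateConjecture" "MGHD existence (Choquet-Bruhat–Geroch) as a stated fact"] Summit.FinalStateConjecture.FinalStateConjecture.Theses.CriticalAncestry.MGHDExists
-- stmt-FinalStateConjecture-17269 · WeakCosmicCensorshipTame · weak cosmic censorship
attribute [hard_core "FinalStateConjecture" "weak cosmic censorship"] Summit.FinalStateConjecture.FinalStateConjecture.Theses.PhaseMixingCapture.WeakCosmicCensorshipTame
-- stmt-FinalStateConjecture-10745 · EternalStationaryExteriorIsKerr · smooth Hawking rigidity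
attribute [hard_core "FinalStateConjecture" "smooth Hawking rigidity"] Summit.FinalStateConjecture.FinalStateConjecture.Theses.EternalPapapetrou.EternalStationaryExteriorIsKerr
-- stmt-FinalStateConjecture-17308 · GenericCensoredCapture · full-range Kerr stability
attribute [hard_core "FinalStateConjecture" "full-range Kerr stability"] Summit.FinalStateConjecture.FinalStateConjecture.Theses.EternalPapapetrou.GenericCensoredCapture
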